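import Summits.Ventures.LatticeQCDFlow.Scaling.ExtensiveSpecificHeatHeatBath

/-!
HONEST FRAMING: exact (Metropolis-corrected) sampling algorithms for lattice gauge theory; figures
of merit are autocorrelation/cost numbers at stated couplings and volumes; no continuum-physics
claim.

# ExtensiveSpecificHeatInnovations — HEAT-BATH INNOVATIONS `D_e = S_W − K_e S_W`: ORTHOGONALITY,
# `∑_{e∈M} ∫ D_e² dπ_β ≤ Var_{π_β}(S_W)`, AND THE ONE-LINK FLOOR (theory2 item 126, PART 2 of 4: §3–§4)

CUSTODY: theory2 item 126 (GEN-39, HOME tier) re-landed by lean-2 GEN-9 per LEAD LINE 245 RT-30 (202);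
statements and proofs = HOME/lean/theory2/ExtensiveSpecificHeat.lean 21be0330075c0491 (1 051 l) verbatim,
split below the `lint.size` line into FOUR files (`…HeatBath` §1–§2, `…Innovations` §3–§4, `…Staple`
§5–§6, `ExtensiveSpecificHeat` §7); headers trimmed; landing edits: docstrings added where the lint asks.

This part: §3 innovations of links with DISJOINT plaquette sets are `π_β`-orthogonal and orthogonal to
functions not depending on the link, hence `∑_{e ∈ M} ∫ D_e² dπ_β ≤ Var_{π_β}(S_W)` for any such family
`M` (`sum_integral_innov_sq_le`); §4 `∫ D_e² dπ_β ≥ exp(−2|β|N·#plaq(e)) · exp(−2|β|N·#plaq(e*)) ·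
∫ A_{e*} Q_e dπ_β`, where `Q_e` (`sqDev`) is the fibre variance of `S_W` under HAAR resampling of `e` and
`A_{e*}` the Haar average over a second link (`integral_innov_sq_ge`; two uses of the tree ENGINE's
one-link density sandwich `lintegral_oneLink_le_wilsonMeasure`).
-/

noncomputable section

set_option linter.unusedSectionVars false

namespace Summit.Ventures.LatticeQCDFlow.Theory2.ExtensiveSpecificHeat

open MeasureTheory ProbabilityTheory Literature.MathematicalPhysics.QuantumFieldTheory
open Summit.Ventures.LatticeQCDFlow.TrivializingMaps
open scoped ENNReal

/-! ## §3 Heat-bath innovations `D_e = S − K_e S`: orthogonality and the sum inequality -/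

section Innovations

variable {d L N : ℕ} [NeZero L] {G : Type*} [Group G] [TopologicalSpace G] [IsTopologicalGroup G]
  [CompactSpace G] [MeasurableSpace G] [BorelSpace G] [SecondCountableTopology G]
  [DecidableEq (Edge d L)] (ρ : G →* Matrix (Fin N) (Fin N) ℂ)

/-- **The heat-bath innovation** of the action at the link `e`: `D_e := S − K_e S`. -/
def innov (β : ℝ) (e : Edge d L) (U : GaugeConfig d L G) : ℝ :=
  wilsonAction ρ U - hb ρ β e (wilsonAction ρ) U

/-- The innovation `D_e` is continuous. [folklore] -/
theorem continuous_innov (hρ : Continuous ρ) (β : ℝ) (e : Edge d L) :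
    Continuous (innov ρ β e) :=
  (continuous_wilsonAction' ρ hρ).sub (continuous_hb ρ hρ β e (continuous_wilsonAction' ρ hρ))

/-- Changing a link `e` whose plaquettes are disjoint from those of `e'` shifts the action by the
same amount along the whole `e'`-fibre. -/
theorem wilsonAction_mulSingle_mulSingle_of_disjoint {e e' : Edge d L} (hne : e ≠ e')
    (hdis : Disjoint (plaqsThrough e) (plaqsThrough e')) (h h' : G) (U : GaugeConfig d L G) :
    wilsonAction ρ (Pi.mulSingle e' h' * (Pi.mulSingle e h * U))
      = wilsonAction ρ (Pi.mulSingle e' h' * U)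
        + (wilsonAction ρ (Pi.mulSingle e h * U) - wilsonAction ρ U) := by
  rw [← mulSingle_comm_mul hne]
  have h1 := WitnessColumn.wilsonAction_mulSingle_sub_eq ρ e h (Pi.mulSingle e' h' * U)
  have h2 := WitnessColumn.wilsonAction_mulSingle_sub_eq ρ e h U
  have hsum : ∑ p ∈ plaqsThrough e, (WilsonRP.plaqRe ρ (Pi.mulSingle e' h' * U) p
        - WilsonRP.plaqRe ρ (Pi.mulSingle e h * (Pi.mulSingle e' h' * U)) p)
      = ∑ p ∈ plaqsThrough e,
          (WilsonRP.plaqRe ρ U p - WilsonRP.plaqRe ρ (Pi.mulSingle e h * U) p) := by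
    refine Finset.sum_congr rfl fun p hp => ?_
    have hp' : p ∉ plaqsThrough e' := Finset.disjoint_left.1 hdis hp
    rw [WitnessColumn.plaqRe_mulSingle_of_not_mem ρ hp', mulSingle_comm_mul hne,
      WitnessColumn.plaqRe_mulSingle_of_not_mem ρ hp']
  linarith [h1, h2, hsum]

/-- `D_{e'}` does not depend on a link `e` whose plaquettes are disjoint from those of `e'`. -/
theorem innov_mulSingle_of_disjoint (hρ : Continuous ρ) (β : ℝ) {e e' : Edge d L} (hne : e ≠ e')
    (hdis : Disjoint (plaqsThrough e) (plaqsThrough e')) (h : G) (U : GaugeConfig d L G) :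
    innov ρ β e' (Pi.mulSingle e h * U) = innov ρ β e' U := by
  unfold innov
  have hS : ∀ h' : G, wilsonAction ρ (Pi.mulSingle e' h' * (Pi.mulSingle e h * U))
      = wilsonAction ρ (Pi.mulSingle e' h' * U)
        + (wilsonAction ρ (Pi.mulSingle e h * U) - wilsonAction ρ U) :=
    fun h' => wilsonAction_mulSingle_mulSingle_of_disjoint ρ hne hdis h h' U
  rw [hb_wilsonAction_eq_add ρ hρ β e' hS]
  ring

/-- `∫ (S − a)·D_e dπ_β = ∫ D_e² dπ_β` for every constant `a` (orthogonality with `K_e S − a`). -/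
theorem integral_sub_const_mul_innov (hρ : Continuous ρ) (β : ℝ) (e : Edge d L) (a : ℝ) :
    ∫ U, (wilsonAction ρ U - a) * innov ρ β e U ∂wilsonMeasure ρ β
      = ∫ U, (innov ρ β e U) ^ 2 ∂wilsonMeasure ρ β := by
  haveI := isProbabilityMeasure_wilsonMeasure (d := d) (L := L) ρ hρ β
  have hS : Continuous (wilsonAction (d := d) (L := L) (G := G) ρ) := continuous_wilsonAction' ρ hρ
  have hK : Continuous (hb ρ β e (wilsonAction ρ)) := continuous_hb ρ hρ β e hS
  have horth := integral_sub_hb_mul_eq_zero ρ hρ β e (f := wilsonAction ρ)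
    (g := fun U => hb ρ β e (wilsonAction ρ) U - a) hS (hK.sub continuous_const)
    (fun h U => by rw [hb_mulSingle])
  have hi1 : Integrable (fun U => (innov ρ β e U) ^ 2) (wilsonMeasure ρ β) :=
    integrable_of_continuous_config ((continuous_innov ρ hρ β e).pow 2)
  have hi2 : Integrable (fun U => (wilsonAction ρ U - hb ρ β e (wilsonAction ρ) U)
      * (hb ρ β e (wilsonAction ρ) U - a)) (wilsonMeasure ρ β) :=
    integrable_of_continuous_config ((hS.sub hK).mul (hK.sub continuous_const))
  calc ∫ U, (wilsonAction ρ U - a) * innov ρ β e U ∂wilsonMeasure ρ β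
      = ∫ U, ((innov ρ β e U) ^ 2 + (wilsonAction ρ U - hb ρ β e (wilsonAction ρ) U)
          * (hb ρ β e (wilsonAction ρ) U - a)) ∂wilsonMeasure ρ β := by
        refine integral_congr_ae (ae_of_all _ fun U => ?_); simp only [innov]; ring
    _ = ∫ U, (innov ρ β e U) ^ 2 ∂wilsonMeasure ρ β
          + ∫ U, (wilsonAction ρ U - hb ρ β e (wilsonAction ρ) U)
              * (hb ρ β e (wilsonAction ρ) U - a) ∂wilsonMeasure ρ β := integral_add hi1 hi2
    _ = ∫ U, (innov ρ β e U) ^ 2 ∂wilsonMeasure ρ β := by rw [horth, add_zero]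

/-- **Innovations at links with disjoint plaquette sets are orthogonal**: `∫ D_e·D_{e'} dπ_β = 0`. -/
theorem integral_innov_mul_innov_eq_zero (hρ : Continuous ρ) (β : ℝ) {e e' : Edge d L}
    (hne : e ≠ e') (hdis : Disjoint (plaqsThrough e) (plaqsThrough e')) :
    ∫ U, innov ρ β e U * innov ρ β e' U ∂wilsonMeasure ρ β = 0 :=
  integral_sub_hb_mul_eq_zero ρ hρ β e (f := wilsonAction ρ) (g := innov ρ β e')
    (continuous_wilsonAction' ρ hρ) (continuous_innov ρ hρ β e')
    (fun h U => innov_mulSingle_of_disjoint ρ hρ β hne hdis h U)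

/-- **THE SUM INEQUALITY.** For a family `M` of links with pairwise disjoint plaquette sets and every
constant `a`: `Σ_{e ∈ M} ∫ D_e² dπ_β ≤ ∫ (S − a)² dπ_β` (Bessel's inequality for the orthogonal family
`(D_e)_{e ∈ M}`, each of which is orthogonal to `S − a − D_e`). -/
theorem sum_integral_innov_sq_le (hρ : Continuous ρ) (β : ℝ) (M : Finset (Edge d L))
    (hM : ∀ e ∈ M, ∀ e' ∈ M, e ≠ e' → Disjoint (plaqsThrough e) (plaqsThrough e')) (a : ℝ) :
    ∑ e ∈ M, ∫ U, (innov ρ β e U) ^ 2 ∂wilsonMeasure ρ β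
      ≤ ∫ U, (wilsonAction ρ U - a) ^ 2 ∂wilsonMeasure (d := d) (L := L) ρ β := by
  haveI := isProbabilityMeasure_wilsonMeasure (d := d) (L := L) ρ hρ β
  have hS : Continuous (wilsonAction (d := d) (L := L) (G := G) ρ) := continuous_wilsonAction' ρ hρ
  have hD : ∀ e : Edge d L, Continuous (innov ρ β e) := fun e => continuous_innov ρ hρ β e
  have key : ∀ T : Finset (Edge d L), T ⊆ M →
      ∫ U, (wilsonAction ρ U - a - ∑ e ∈ T, innov ρ β e U) ^ 2 ∂wilsonMeasure ρ β
        = ∫ U, (wilsonAction ρ U - a) ^ 2 ∂wilsonMeasure (d := d) (L := L) ρ β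
          - ∑ e ∈ T, ∫ U, (innov ρ β e U) ^ 2 ∂wilsonMeasure ρ β := by
    intro T
    induction T using Finset.induction_on with
    | empty => intro; simp
    | insert e T heT ih =>
      intro hsub
      have hTsub : T ⊆ M := fun x hx => hsub (Finset.mem_insert_of_mem hx)
      have heM : e ∈ M := hsub (Finset.mem_insert_self _ _)
      have hR : Continuous fun U => wilsonAction ρ U - a - ∑ e' ∈ T, innov ρ β e' U :=
        (hS.sub continuous_const).sub (continuous_finsetSum _ fun e' _ => hD e')
      have h0 : ∀ e' ∈ T, ∫ U, innov ρ β e' U * innov ρ β e U ∂wilsonMeasure ρ β = 0 :=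
        fun e' he' => by
          have hne : e' ≠ e := fun hh => heT (hh ▸ he')
          exact integral_innov_mul_innov_eq_zero ρ hρ β hne (hM e' (hTsub he') e heM hne)
      have hcross : ∫ U, (wilsonAction ρ U - a - ∑ e' ∈ T, innov ρ β e' U) * innov ρ β e U
            ∂wilsonMeasure ρ β
          = ∫ U, (innov ρ β e U) ^ 2 ∂wilsonMeasure ρ β := by
        have hi1 : Integrable (fun U => (wilsonAction ρ U - a) * innov ρ β e U)
            (wilsonMeasure ρ β) :=
          integrable_of_continuous_config ((hS.sub continuous_const).mul (hD e))
        have hi2 : Integrable (fun U => ∑ e' ∈ T, innov ρ β e' U * innov ρ β e U)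
            (wilsonMeasure ρ β) :=
          integrable_finsetSum T (f := fun e' U => innov ρ β e' U * innov ρ β e U)
            fun e' _ => integrable_of_continuous_config ((hD e').mul (hD e))
        calc ∫ U, (wilsonAction ρ U - a - ∑ e' ∈ T, innov ρ β e' U) * innov ρ β e U
              ∂wilsonMeasure ρ β
            = ∫ U, ((wilsonAction ρ U - a) * innov ρ β e U
                - ∑ e' ∈ T, innov ρ β e' U * innov ρ β e U) ∂wilsonMeasure ρ β := by
              refine integral_congr_ae (ae_of_all _ fun U => ?_)
              simp only
              rw [sub_mul, Finset.sum_mul]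
          _ = ∫ U, (wilsonAction ρ U - a) * innov ρ β e U ∂wilsonMeasure ρ β
                - ∫ U, ∑ e' ∈ T, innov ρ β e' U * innov ρ β e U ∂wilsonMeasure ρ β :=
              integral_sub hi1 hi2
          _ = ∫ U, (innov ρ β e U) ^ 2 ∂wilsonMeasure ρ β := by
              rw [integral_sub_const_mul_innov ρ hρ β e a,
                integral_finsetSum T (f := fun e' U => innov ρ β e' U * innov ρ β e U)
                  fun e' _ => integrable_of_continuous_config ((hD e').mul (hD e)),
                Finset.sum_eq_zero h0, sub_zero]
      have hi1 : Integrable (fun U => (wilsonAction ρ U - a - ∑ e' ∈ T, innov ρ β e' U) ^ 2)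
          (wilsonMeasure ρ β) := integrable_of_continuous_config (hR.pow 2)
      have hi2 : Integrable (fun U => 2 * ((wilsonAction ρ U - a - ∑ e' ∈ T, innov ρ β e' U)
          * innov ρ β e U)) (wilsonMeasure ρ β) :=
        (integrable_of_continuous_config (hR.mul (hD e))).const_mul 2
      have hi3 : Integrable (fun U => (innov ρ β e U) ^ 2) (wilsonMeasure ρ β) :=
        integrable_of_continuous_config ((hD e).pow 2)
      simp only [Finset.sum_insert heT]
      calc ∫ U, (wilsonAction ρ U - a - (innov ρ β e U + ∑ e' ∈ T, innov ρ β e' U)) ^ 2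
            ∂wilsonMeasure ρ β
          = ∫ U, ((wilsonAction ρ U - a - ∑ e' ∈ T, innov ρ β e' U) ^ 2
              - 2 * ((wilsonAction ρ U - a - ∑ e' ∈ T, innov ρ β e' U) * innov ρ β e U)
              + (innov ρ β e U) ^ 2) ∂wilsonMeasure ρ β := by
            refine integral_congr_ae (ae_of_all _ fun U => ?_); simp only; ring
        _ = ∫ U, (wilsonAction ρ U - a - ∑ e' ∈ T, innov ρ β e' U) ^ 2 ∂wilsonMeasure ρ β
              - ∫ U, 2 * ((wilsonAction ρ U - a - ∑ e' ∈ T, innov ρ β e' U) * innov ρ β e U)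
                  ∂wilsonMeasure ρ β
              + ∫ U, (innov ρ β e U) ^ 2 ∂wilsonMeasure ρ β := by
            rw [integral_add (hi1.sub' hi2) hi3, integral_sub hi1 hi2]
        _ = ∫ U, (wilsonAction ρ U - a) ^ 2 ∂wilsonMeasure (d := d) (L := L) ρ β
              - (∫ U, (innov ρ β e U) ^ 2 ∂wilsonMeasure ρ β
                  + ∑ e' ∈ T, ∫ U, (innov ρ β e' U) ^ 2 ∂wilsonMeasure ρ β) := by
            rw [integral_const_mul, hcross, ih hTsub]; ring
  have hfin := key M subset_rfl
  have hnonneg : 0 ≤ ∫ U, (wilsonAction ρ U - a - ∑ e ∈ M, innov ρ β e U) ^ 2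
      ∂wilsonMeasure ρ β := integral_nonneg fun U => sq_nonneg _
  linarith

end Innovations

/-! ## §4 The one-link floor: ENGINE (twice) and the fibre variance -/

section Floor

variable {d L N : ℕ} [NeZero L] {G : Type*} [Group G] [TopologicalSpace G] [IsTopologicalGroup G]
  [CompactSpace G] [MeasurableSpace G] [BorelSpace G] [SecondCountableTopology G]
  [DecidableEq (Edge d L)] (ρ : G →* Matrix (Fin N) (Fin N) ℂ)

/-- **Real form of the one-link ENGINE** (`WitnessColumn.lintegral_oneLink_le_wilsonMeasure`): for
continuous `ψ ≥ 0`, `e^{−2|β|N·#plaqsThrough e} · ∫ A_e ψ dπ_β ≤ ∫ ψ dπ_β`. -/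
theorem exp_mul_integral_linkAvg_le (hρ : Continuous ρ) (β : ℝ) (e : Edge d L)
    {ψ : GaugeConfig d L G → ℝ} (hψ : Continuous ψ) (hψ0 : ∀ U, 0 ≤ ψ U) :
    Real.exp (-(2 * |β| * N * ((plaqsThrough e).card : ℝ)))
        * ∫ U, linkAvg e ψ U ∂wilsonMeasure ρ β
      ≤ ∫ U, ψ U ∂wilsonMeasure ρ β := by
  haveI := isProbabilityMeasure_wilsonMeasure (d := d) (L := L) ρ hρ β
  have hψm : Measurable ψ := hψ.measurable
  have hE := WitnessColumn.lintegral_oneLink_le_wilsonMeasure ρ hρ β e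
    (F := fun U => ENNReal.ofReal (ψ U)) (ENNReal.measurable_ofReal.comp hψm)
  have hinner : ∀ U : GaugeConfig d L G,
      ∫⁻ h, ENNReal.ofReal (ψ (Pi.mulSingle e h * U)) ∂haarProbability G
        = ENNReal.ofReal (linkAvg e ψ U) := fun U =>
    (ofReal_integral_eq_lintegral_ofReal
      (integrable_of_continuous_group (φ := fun h => ψ (Pi.mulSingle e h * U))
        (hψ.comp (continuous_mulSingle_mul e U))) (ae_of_all _ fun h => hψ0 _)).symm
  simp only [hinner] at hE
  have hA0 : ∀ U, 0 ≤ linkAvg e ψ U := fun U => integral_nonneg fun h => hψ0 _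
  rw [← ofReal_integral_eq_lintegral_ofReal
        (integrable_of_continuous_config (continuous_linkAvg e hψ)) (ae_of_all _ hA0),
    ← ofReal_integral_eq_lintegral_ofReal (integrable_of_continuous_config hψ) (ae_of_all _ hψ0),
    ← ENNReal.ofReal_mul (Real.exp_pos _).le] at hE
  exact (ENNReal.ofReal_le_ofReal_iff (integral_nonneg hψ0)).1 hE

/-- The fibre mean `A_e S (U) = ∫ S(h ·ₑ U) dh`. -/
def fibreMean (e : Edge d L) (U : GaugeConfig d L G) : ℝ := linkAvg e (wilsonAction ρ) U

/-- The fibre mean is invariant along the fibre. [folklore] -/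
theorem fibreMean_mulSingle (e : Edge d L) (h : G) (U : GaugeConfig d L G) :
    fibreMean ρ e (Pi.mulSingle e h * U) = fibreMean ρ e U :=
  linkAvg_mulSingle e _ h U

/-- **The fibre variance** `Q_e(U) = ∫ (S(h ·ₑ U) − A_e S(U))² dh`: the variance of the action along
the `e`-fibre under HAAR resampling of the link `e`. -/
def sqDev (e : Edge d L) (U : GaugeConfig d L G) : ℝ :=
  ∫ h, (wilsonAction ρ (Pi.mulSingle e h * U) - fibreMean ρ e U) ^ 2 ∂haarProbability G

/-- `sqDev` as a one-link Haar average. [folklore] -/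
theorem sqDev_eq_linkAvg (e : Edge d L) :
    sqDev ρ e = linkAvg e (fun V => (wilsonAction ρ V - fibreMean ρ e V) ^ 2) := by
  funext U
  unfold sqDev linkAvg
  congr 1
  funext h
  simp only [fibreMean_mulSingle]

/-- `sqDev ≥ 0`. [folklore] -/
theorem sqDev_nonneg (e : Edge d L) (U : GaugeConfig d L G) : 0 ≤ sqDev ρ e U :=
  integral_nonneg fun _ => sq_nonneg _

/-- `sqDev` is continuous. [folklore] -/
theorem continuous_sqDev (hρ : Continuous ρ) (e : Edge d L) : Continuous (sqDev ρ e) := by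
  rw [sqDev_eq_linkAvg]
  have hS : Continuous (wilsonAction (d := d) (L := L) (G := G) ρ) := continuous_wilsonAction' ρ hρ
  exact continuous_linkAvg e ((hS.sub (continuous_linkAvg e hS)).pow 2)

/-- The fibre variance is at most the fibre mean square of the innovation:
`Q_e(U) ≤ A_e (D_e²)(U)` (a mean square about any constant dominates the variance). -/
theorem sqDev_le_linkAvg_innov_sq (hρ : Continuous ρ) (β : ℝ) (e : Edge d L)
    (U : GaugeConfig d L G) :
    sqDev ρ e U ≤ linkAvg e (fun V => (innov ρ β e V) ^ 2) U := by
  have hS : Continuous (wilsonAction (d := d) (L := L) (G := G) ρ) := continuous_wilsonAction' ρ hρ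
  have hX : Continuous fun h : G => wilsonAction ρ (Pi.mulSingle e h * U) :=
    hS.comp (continuous_mulSingle_mul e U)
  obtain ⟨C, hC⟩ := WitnessColumn.exists_abs_le_of_continuous hX
  have h1 := WitnessColumn.integral_sub_const_sq (haarProbability G) hX.measurable hC
    (fibreMean ρ e U)
  have h2 := WitnessColumn.integral_sub_const_sq (haarProbability G) hX.measurable hC
    (hb ρ β e (wilsonAction ρ) U)
  have hmean : ∫ h, wilsonAction ρ (Pi.mulSingle e h * U) ∂haarProbability G = fibreMean ρ e U :=
    rfl
  unfold sqDev linkAvg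
  simp only [innov, hb_mulSingle]
  rw [h1, h2, hmean]
  nlinarith [sq_nonneg (fibreMean ρ e U - hb ρ β e (wilsonAction ρ) U)]

/-- **ONE-LINK FLOOR.** For every pair of links `e, e⋆`:
`e^{−2|β|N k_e} · e^{−2|β|N k_{e⋆}} · ∫ A_{e⋆} Q_e dπ_β ≤ ∫ D_e² dπ_β` (ENGINE at `e`, the fibre
variance bound, ENGINE at `e⋆`). -/
theorem integral_innov_sq_ge (hρ : Continuous ρ) (β : ℝ) (e estar : Edge d L) :
    Real.exp (-(2 * |β| * N * ((plaqsThrough e).card : ℝ)))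
        * (Real.exp (-(2 * |β| * N * ((plaqsThrough estar).card : ℝ)))
          * ∫ U, linkAvg estar (sqDev ρ e) U ∂wilsonMeasure ρ β)
      ≤ ∫ U, (innov ρ β e U) ^ 2 ∂wilsonMeasure ρ β := by
  haveI := isProbabilityMeasure_wilsonMeasure (d := d) (L := L) ρ hρ β
  have hQ := continuous_sqDev ρ hρ e
  have hD2 : Continuous fun V => (innov ρ β e V) ^ 2 := (continuous_innov ρ hρ β e).pow 2
  -- ENGINE at `e⋆` for `ψ = Q_e`
  have h3 := exp_mul_integral_linkAvg_le ρ hρ β estar hQ (sqDev_nonneg ρ e)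
  -- `∫ Q_e ≤ ∫ A_e (D_e²)`
  have h2 : ∫ U, sqDev ρ e U ∂wilsonMeasure ρ β
      ≤ ∫ U, linkAvg e (fun V => (innov ρ β e V) ^ 2) U ∂wilsonMeasure ρ β :=
    integral_mono (integrable_of_continuous_config hQ)
      (integrable_of_continuous_config (continuous_linkAvg e hD2))
      fun U => sqDev_le_linkAvg_innov_sq ρ hρ β e U
  -- ENGINE at `e` for `ψ = D_e²`
  have h1 := exp_mul_integral_linkAvg_le ρ hρ β e hD2 fun U => sq_nonneg _
  have hc : 0 ≤ Real.exp (-(2 * |β| * N * ((plaqsThrough e).card : ℝ))) := (Real.exp_pos _).le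
  calc Real.exp (-(2 * |β| * N * ((plaqsThrough e).card : ℝ)))
        * (Real.exp (-(2 * |β| * N * ((plaqsThrough estar).card : ℝ)))
          * ∫ U, linkAvg estar (sqDev ρ e) U ∂wilsonMeasure ρ β)
      ≤ Real.exp (-(2 * |β| * N * ((plaqsThrough e).card : ℝ)))
          * ∫ U, linkAvg e (fun V => (innov ρ β e V) ^ 2) U ∂wilsonMeasure ρ β :=
        mul_le_mul_of_nonneg_left (h3.trans h2) hc
    _ ≤ ∫ U, (innov ρ β e U) ^ 2 ∂wilsonMeasure ρ β := h1

end Floor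

end Summit.Ventures.LatticeQCDFlow.Theory2.ExtensiveSpecificHeat
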